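import Summits.CriticalPhenomena.Ising3DConformalLimit.Theses.PrecisionLaplacian
import Summits.CriticalPhenomena.Ising3DConformalLimit.Theses.BernsteinTemperature
import Summits.CriticalPhenomena.Ising3DConformalLimit.Theses.PrimaryAtInfinity
import Summits.CriticalPhenomena.Ising3DConformalLimit.Theses.PerfectScreening
import Summits.CriticalPhenomena.Ising3DConformalLimit.Theses.IsingEuclidUpgrade
import Summits.CriticalPhenomena.Ising3DConformalLimit.Theorems.MoebiusLimitOfTwoPointLaw.Negative.ReadBack
import Summits.CriticalPhenomena.Ising3DConformalLimit.Theorems.PrecisionLaplacianMoebiusLimitOfTwoPointLawTwoShellGlue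
import HarnessLib

/-!
# Crux `MoebiusLimitOfTwoPointLaw` (item stmt-CriticalPhenomena-4801): the dependency edge through route
# `PrimaryAtInfinity` (line `multipole-ward-nonsat-endpoint`, recorded, not built)

The second passing line of the crux (`Cruxes/MoebiusLimitOfTwoPointLaw/Lines/multipole_ward_nonsat_endpoint.lean`,
front matter `lead_recommendation: do-not-build`) is a pure COMPOSITION: its six stubs are the decls of items
1342 (`PerfectScreening.NonSaturation`), 5355, 5352, 5353, 5356, 5357 (`PrimaryAtInfinity.ExistsRegularLimit /
FirstMultipoleIdentity / FarFieldClustering / MultipoleToWard / WardToMoebius`) BY NAME. This file lands its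
sorry-free content, as its planner and the three triagers asked, so that the two inter-route edges are in the tree:

* `twoPointPowerLawEta_of_nonSaturation` : item 5354 `PrimaryAtInfinity.TwoPointPowerLawEta` ⇐ item 1342 ∧ item 0634
  (`IsingEuclidUpgrade.IsingEuclidUpgradeR2RotInvPowerLaw`, verbatim the hypothesis of the crux): glue B1 (landed,
  `Negative.twoPointLaw_exponent_gt_half_of_nonSaturation`: `1/2 < Δ`) + glue B2 (`twoPoint_of_limit` of
  `PrecisionLaplacianMoebiusLimitOfTwoPointLawTwoShellGlue.lean`: `S₂ = S₂(0,e₁)‖a−b‖^{-2Δ}` for every non-degenerate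
  limit). PrimaryAtInfinity's own two-point crux is therefore item 0634 plus the `η > 0` endpoint, nothing more.
* `moebiusLimitOfTwoPointLaw_of_primaryAtInfinity` : the crux ⇐ items 1342, 5355, 5352, 5353, 5356, 5357 — verbatim
  the deciding theorem of route PrimaryAtInfinity minus clause (iii), with 5354 discharged as above; both host-route
  spellings.

All hypotheses are OPEN items of other routes (four of them open-problem sized); nothing here attacks them.
References: line card `Cruxes/MoebiusLimitOfTwoPointLaw/Lines/multipole-ward-nonsat-endpoint.md`; Di Francesco–
Mathieu–Sénéchal 1997 §4.2–4.3 (Ward identities) [FrancescoMathieuSenechal1997]; Duminil-Copin ICM 2022 §8.4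
[DuminilCopinICM2022].
-/

noncomputable section

namespace Summit.CriticalPhenomena.Ising3DConformalLimit.PrecisionLaplacianMoebiusLimitOfTwoPointLaw

open Literature.Probability.LatticeModels Filter Topology
open Summit.CriticalPhenomena.Ising3DConformalLimit.Theses
open Summit.CriticalPhenomena.Ising3DConformalLimit.Theorems.MoebiusLimitOfTwoPointLaw

/-- **Edge 5354 ⇐ 1342 ∧ 0634.** `PerfectScreening.NonSaturation` (item 1342) and
`IsingEuclidUpgrade.IsingEuclidUpgradeR2RotInvPowerLaw` (item 0634, the crux hypothesis verbatim) imply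
`PrimaryAtInfinity.TwoPointPowerLawEta` (item 5354): B1 pins `1/2 < Δ`
(`Negative.twoPointLaw_exponent_gt_half_of_nonSaturation`) and `twoPoint_of_limit` identifies
`S₂(a,b) = c'‖a−b‖^{-2Δ}`, `c' > 0`, for every non-degenerate pointwise limit. -/
theorem twoPointPowerLawEta_of_nonSaturation :
    PerfectScreening.NonSaturation → IsingEuclidUpgrade.IsingEuclidUpgradeR2RotInvPowerLaw →
      PrimaryAtInfinity.TwoPointPowerLawEta := by
  intro hNS h0634 ρ S _ hlim hnd
  obtain ⟨Δ, c, hc, hP⟩ := h0634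
  obtain ⟨c', hc', hS2⟩ := twoPoint_of_limit hc hP hlim hnd
  exact ⟨c', Δ, hc', Negative.twoPointLaw_exponent_gt_half_of_nonSaturation hNS hc hP, hS2⟩

/-- **Edge 4801 ⇐ {1342, 5355, 5352, 5353, 5356, 5357}.** NonSaturation → ExistsRegularLimit →
FirstMultipoleIdentity → FarFieldClustering → MultipoleToWard → WardToMoebius → the crux: given item 0634 (the crux
hypothesis), `twoPointPowerLawEta_of_nonSaturation` supplies item 5354; then verbatim the deciding theorem of route
PrimaryAtInfinity minus clause (iii): the regular limit `(ρ, S)` of 5355 has `S₂ = c‖a−b‖^{-2Δ}` with `Δ > 1/2 > 0`,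
5352 + 5353 feed 5356 (weak special-conformal Ward identities for every `S_n`), and 5357 integrates them to
`IsMoebiusCovariant Δ S`. -/
theorem moebiusLimitOfTwoPointLaw_of_primaryAtInfinity :
    PerfectScreening.NonSaturation → PrimaryAtInfinity.ExistsRegularLimit →
      PrimaryAtInfinity.FirstMultipoleIdentity → PrimaryAtInfinity.FarFieldClustering →
      PrimaryAtInfinity.MultipoleToWard → PrimaryAtInfinity.WardToMoebius →
      PrecisionLaplacian.MoebiusLimitOfTwoPointLaw := by
  intro hNS hE h₁ h₂ h₆ h₇ h0634
  have h₃ : PrimaryAtInfinity.TwoPointPowerLawEta := twoPointPowerLawEta_of_nonSaturation hNS h0634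
  obtain ⟨ρ, S, hρ, hlim, hnorm, hnd, htr, hpar, hcont⟩ := hE
  obtain ⟨c, Δ, hc, hΔ, hS2⟩ := h₃ ρ S hρ hlim hnd
  have hward := h₆ S c Δ hc.ne' hcont (fun n => by
    obtain ⟨A₀, A₁, hA, hid⟩ := h₁ ρ S c Δ hρ hlim hnorm hc hS2 (n + 1)
    obtain ⟨hmono, hdip⟩ := h₂ ρ S c Δ hρ hlim hnorm hc hS2 n A₀ A₁ hA
    exact ⟨A₀, A₁, hA, hid, hmono, hdip⟩)
  have hmoeb : IsMoebiusCovariant Δ S := h₇ S Δ hnorm hcont htr hpar hward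
  exact ⟨ρ, Δ, S, hρ, by linarith, hlim, hnd, hmoeb⟩

/-- The same edge under the second host route's spelling of the crux (`Theses.BernsteinTemperature`). -/
theorem moebiusLimitOfTwoPointLaw_of_primaryAtInfinity' :
    PerfectScreening.NonSaturation → PrimaryAtInfinity.ExistsRegularLimit →
      PrimaryAtInfinity.FirstMultipoleIdentity → PrimaryAtInfinity.FarFieldClustering →
      PrimaryAtInfinity.MultipoleToWard → PrimaryAtInfinity.WardToMoebius →
      BernsteinTemperature.MoebiusLimitOfTwoPointLaw :=
  moebiusLimitOfTwoPointLaw_of_primaryAtInfinity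

/-- **Sharper edge 4801 ⇐ {5355, 5352, 5353, 5356, 5357}: item 1342 (`NonSaturation`, the `η > 0` endpoint) is NOT
needed for the crux** (lead gen-1 observation). Under the crux hypothesis (item 0634, two-point law with witness `(Δ, c)`,
`0 < c`) the exponent is already forced into `[1/2, 1]` (`twoPointLaw_exponent_mem_Icc`, landed p68682), so `0 < Δ`
(`twoPointLaw_exponent_pos`) — the only use the assembly makes of `1/2 < Δ` — holds without `NonSaturation`; and
`twoPoint_of_limit` identifies `S₂ = c'‖a−b‖^{-2Δ}` (`c' > 0`) for the regular limit of item 5355, which is all that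
`FirstMultipoleIdentity` / `FarFieldClustering` / `MultipoleToWard` consume (`c' ≠ 0`). Hence
ExistsRegularLimit → FirstMultipoleIdentity → FarFieldClustering → MultipoleToWard → WardToMoebius → the crux. -/
theorem moebiusLimitOfTwoPointLaw_of_primaryAtInfinity_sharp :
    PrimaryAtInfinity.ExistsRegularLimit →
      PrimaryAtInfinity.FirstMultipoleIdentity → PrimaryAtInfinity.FarFieldClustering →
      PrimaryAtInfinity.MultipoleToWard → PrimaryAtInfinity.WardToMoebius →
      PrecisionLaplacian.MoebiusLimitOfTwoPointLaw := by
  intro hE h₁ h₂ h₆ h₇ h0634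
  obtain ⟨Δ, c, hc, hP⟩ := h0634
  obtain ⟨ρ, S, hρ, hlim, hnorm, hnd, htr, hpar, hcont⟩ := hE
  obtain ⟨c', hc', hS2⟩ := twoPoint_of_limit hc hP hlim hnd
  have hward := h₆ S c' Δ hc'.ne' hcont (fun n => by
    obtain ⟨A₀, A₁, hA, hid⟩ := h₁ ρ S c' Δ hρ hlim hnorm hc' hS2 (n + 1)
    obtain ⟨hmono, hdip⟩ := h₂ ρ S c' Δ hρ hlim hnorm hc' hS2 n A₀ A₁ hA
    exact ⟨A₀, A₁, hA, hid, hmono, hdip⟩)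
  have hmoeb : IsMoebiusCovariant Δ S := h₇ S Δ hnorm hcont htr hpar hward
  exact ⟨ρ, Δ, S, hρ, twoPointLaw_exponent_pos hc hP, hlim, hnd, hmoeb⟩

/-- The sharper edge under the second host route's spelling of the crux (`Theses.BernsteinTemperature`). -/
theorem moebiusLimitOfTwoPointLaw_of_primaryAtInfinity_sharp' :
    PrimaryAtInfinity.ExistsRegularLimit →
      PrimaryAtInfinity.FirstMultipoleIdentity → PrimaryAtInfinity.FarFieldClustering →
      PrimaryAtInfinity.MultipoleToWard → PrimaryAtInfinity.WardToMoebius →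
      BernsteinTemperature.MoebiusLimitOfTwoPointLaw :=
  moebiusLimitOfTwoPointLaw_of_primaryAtInfinity_sharp

end Summit.CriticalPhenomena.Ising3DConformalLimit.PrecisionLaplacianMoebiusLimitOfTwoPointLaw

end
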